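import Mathlib
import Summits.ValiantsHypothesis.ValiantsHypothesis.Theorems.GeneratorObstructionsPerGenDegreeSuperQPPaddedGadget
import Summits.ValiantsHypothesis.ValiantsHypothesis.Theorems.GeneratorObstructionsPerGenDegreeSuperQPPaddedLateness
import Summits.ValiantsHypothesis.ValiantsHypothesis.Theorems.GeneratorObstructionsPowGenDegreeQPDoublingGadgetWindow
import Summits.ValiantsHypothesis.ValiantsHypothesis.Theorems.GeneratorObstructionsGenInheritanceUpper

/-!
# Route GeneratorObstructions — crux K1 `PerGenDegreeSuperQP` (stmt-ValiantsHypothesis-11654), line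
# `per-side-atoms`: K1 reduced to ONE padded certificate

Helper file (`--supports stmt-ValiantsHypothesis-11654`).  Assembly of the padded-gadget route:
`…PerGenDegreeSuperQPPaddedGadget` (the padded doubling gadget
`p = x_z^{(c-1)5k+1} Σ_{j<c} x_{B j}^k x_{A j}^{2k} x_{A' j}^{2k}` is a degeneration of `per_{5kc+1}`, hub
construction), `…PerGenDegreeSuperQPPaddedLateness` (its stabiliser forces `-|χ| ≥ 2^c` on every
nonzero dominant weight it annihilates) and the evaluation-lateness mechanism
(`exists_genType_of_not_le_ker_evalAtPoint`, generator principle `finrank_ne_zero_of_mem_orbitClosure`):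

* `padded_gadget_late_genType_of_eval_ne_zero` — one highest-weight vector of nonconstant weight not
  vanishing at `p` ⟹ a nonconstant generator type of `A(Δ p)` with `-|χ| ≥ 2^c`;
* `per_late_genType_of_paddedGIT` — … hence of `A(Δ per_{5kc+1})` (strictly monotone placement `ι` of
  the `3c+1` letters, padding letter on top);
* `padded_parameters_at` — at `t = 2(2c₀+4)²`, `k = 2^t`, `c = 4^t`, `m = 5kc+1`:
  `m · 2^((log₂ m + c₀)^c₀) < 2^c`;
* `perGenDegreeSuperQP_of_paddedGadgetGIT` — **K1 by name from the padded certificate** (for every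
  `t ≥ 1` and every strictly monotone placement, a nonconstant-weight highest-weight vector nonzero at
  the padded gadget).

So K1 now hinges on a single explicit-certificate question at a point that IS in `Δ(per_m)`
(the cone criterion `-χ* ∈ cone(supp p)` holds; memo v2 on the item).

Honest framing: conditional reduction by name; no stub (`stub_atomLate`), crux or summit is settled
here; `VP ≠ VNP` untouched. [cite: GesmundoIkenmeyerPanova2017, Prop. 5]
-/

namespace Summit.ValiantsHypothesis.ValiantsHypothesis.Theorems.GeneratorObstructions.PerGenDegreeSuperQP

open MvPolynomial
open Literature.NumberTheory.DiophantineGeometry Literature.Computability.AlgebraicComplexity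
open Summit.ValiantsHypothesis.ValiantsHypothesis.Theses.GeneratorObstructions
open Summit.ValiantsHypothesis.ValiantsHypothesis.Theorems.GeneratorObstructions.SliceTransfer
open Summit.ValiantsHypothesis.ValiantsHypothesis.Theorems.GeneratorObstructions.PowGenDegreeQP
open Summit.ValiantsHypothesis.ValiantsHypothesis.Theorems.GenInheritance

-- `Summit.ValiantsHypothesis.ValiantsHypothesis.…` is the tree's mandated single-conjunct layout.
set_option linter.dupNamespace false

noncomputable section

/-! ## §1 Late generator type of the padded gadget from one nonvanishing semi-invariant -/

section Late

variable {σ : Type*} [Fintype σ] [LinearOrder σ] {c k e : ℕ}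

/-- **Late generator type of the padded gadget, given one nonvanishing nonconstant semi-invariant**
(padded twin of `gadget_late_genType_of_eval_ne_zero`): every highest-weight vector of nonconstant
weight not vanishing at `p = x_z^e Σ_j x_{B j}^k x_{A j}^{2k} x_{A' j}^{2k}` has `-|χ| ≥ 2^c`, and if one
exists then `A(Δ_m p)` has a nonconstant generator type with `-|χ| ≥ 2^c`. [folklore] -/
theorem padded_gadget_late_genType_of_eval_ne_zero (B A A' : Fin c → σ) (z : σ) (hc : 0 < c)
    (hk : 1 ≤ k) (hBi : Function.Injective B) (hAi : Function.Injective A)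
    (hA'i : Function.Injective A')
    (hBA : ∀ i j, B i ≠ A j) (hBA' : ∀ i j, B i ≠ A' j) (hAA' : ∀ i j, A i ≠ A' j)
    (hzB : ∀ j, z ≠ B j) (hzA : ∀ j, z ≠ A j) (hzA' : ∀ j, z ≠ A' j)
    (hord1 : ∀ (j : Fin c) (h : j.val + 1 < c), A j < B ⟨j.val + 1, h⟩)
    (hord2 : ∀ (j : Fin c) (h : j.val + 1 < c), B ⟨j.val + 1, h⟩ < A' j)
    (p : MvPolynomial σ ℂ) {m : ℕ} (hm : m ≠ 0)
    (hp : p = X z ^ e * ∑ j : Fin c, X (B j) ^ k * (X (A j) ^ (2 * k) * X (A' j) ^ (2 * k)))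
    (h2 : ∃ χ₀ : Weight σ, (∃ i j, χ₀ i ≠ χ₀ j) ∧
      ∃ x ∈ highestWeightSpace (orbitCoordRep p m) χ₀, evalAtPoint p m x ≠ 0) :
    ∃ χ : Weight σ, (∃ i j, χ i ≠ χ j) ∧ (2 : ℤ) ^ c ≤ -(Weight.size χ) ∧
      Module.finrank ℂ (↥(highestWeightSpace (orbitCoordRep p m) χ) ⧸
        Submodule.comap (highestWeightSpace (orbitCoordRep p m) χ).subtype
          (⨆ q : Weight σ × Weight σ, ⨆ (_ : q.1 + q.2 = χ ∧ q.1 ≠ 0 ∧ q.2 ≠ 0),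
            highestWeightSpace (orbitCoordRep p m) q.1 *
              highestWeightSpace (orbitCoordRep p m) q.2)) ≠ 0 := by
  classical
  haveI : Infinite ℂ := CharZero.infinite ℂ
  obtain ⟨S, hS, hpack⟩ := padded_gadget_lateness_package B A A' z hc hk hBi hAi hA'i hBA hBA'
    hAA' hzB hzA hzA' hord1 hord2 p hp
  refine exists_genType_of_not_le_ker_evalAtPoint p hm (fun χ => (2 : ℤ) ^ c ≤ -(Weight.size χ)) ?_ ?_
  · intro χ hnc hsmall x hx
    rw [LinearMap.mem_ker, AlgHom.toLinearMap_apply]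
    by_cases hx0 : x = 0
    · rw [hx0, map_zero]
    have hocc : HasHighestWeight (orbitCoordRep p m) χ := by
      intro hbot
      rw [hbot, Submodule.mem_bot] at hx
      exact hx0 hx
    obtain ⟨hle, -⟩ := nonpos_and_exists_size_eq_of_hasHighestWeight_orbitCoordRep _ hocc
    have hanti : Antitone χ := isDominant_of_hasHighestWeight_orbitCoordRep _ hocc
    have hne : χ ≠ 0 := by
      obtain ⟨i, j, hij⟩ := hnc
      intro h0
      rw [h0] at hij
      exact hij rfl
    by_cases hall : ∀ t ∈ S, weightChar χ t = 1
    · exact absurd (hpack χ hne hanti hle hall) hsmall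
    · push Not at hall
      obtain ⟨t, htS, hχt⟩ := hall
      exact evalAtPoint_eq_zero_of_fix_of_weightChar_ne_one p m (hS t htS).1 (hS t htS).2 hx hχt
  · obtain ⟨χ₀, hnc, x, hx, hx0⟩ := h2
    exact ⟨χ₀, hnc, fun hle => hx0 (by
      have := hle hx
      rwa [LinearMap.mem_ker, AlgHom.toLinearMap_apply] at this)⟩

end Late

/-! ## §2 The canonical padded placement -/

/-- Position of the padding letter is above all gadget positions. [folklore] -/
theorem canonPos_lt_succ {c : ℕ} (j : Fin c) :
    (if j.val = 0 then 0 else 3 * j.val - 1) < 3 * c + 1 ∧ 3 * j.val + 1 < 3 * c + 1 ∧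
      (if j.val = c - 1 then 3 * c - 1 else 3 * j.val + 3) < 3 * c + 1 := by
  have := j.isLt
  refine ⟨?_, by omega, ?_⟩ <;> split_ifs <;> omega

/-! ## §3 K1 from the padded certificate -/

/-- **A late generator type of `per_{5kc+1}` from the padded certificate.**  For `k, c ≥ 1`,
`m = 5kc + 1` and a strictly monotone `ι : Fin (3c+1) → MatIdx m` (the padding letter `z = ι(3c)` on
top of the canonically ordered gadget letters): if some highest-weight vector of NONCONSTANT weight of
`ℂ[Δ_m p]` does not vanish at the padded gadget `p`, then `A(Δ per_m)` has a nonconstant generator type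
`χ` with `-|χ| ≥ 2^c` (`padded_gadget_late_genType_of_eval_ne_zero`, `padded_gadget_mem_orbitClosure_perPoly`,
generator principle). [folklore] -/
theorem per_late_genType_of_paddedGIT {k c m : ℕ} (hk : 1 ≤ k) (hc : 1 ≤ c) (hm : m = 5 * k * c + 1)
    (ι : Fin (3 * c + 1) → MatIdx m) (hι : StrictMono ι)
    (hGIT : ∃ χ₀ : Weight (MatIdx m), (∃ a b, χ₀ a ≠ χ₀ b) ∧
      ∃ y ∈ highestWeightSpace (orbitCoordRep
          ((X (ι ⟨3 * c, Nat.lt_succ_self _⟩)) ^ ((c - 1) * (5 * k) + 1) *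
            ∑ j : Fin c,
              X (ι ⟨if j.val = 0 then 0 else 3 * j.val - 1, (canonPos_lt_succ j).1⟩) ^ k *
                (X (ι ⟨3 * j.val + 1, (canonPos_lt_succ j).2.1⟩) ^ (2 * k) *
                  X (ι ⟨if j.val = c - 1 then 3 * c - 1 else 3 * j.val + 3,
                    (canonPos_lt_succ j).2.2⟩) ^ (2 * k)) : MvPolynomial (MatIdx m) ℂ) m) χ₀,
        evalAtPoint ((X (ι ⟨3 * c, Nat.lt_succ_self _⟩)) ^ ((c - 1) * (5 * k) + 1) *
            ∑ j : Fin c,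
              X (ι ⟨if j.val = 0 then 0 else 3 * j.val - 1, (canonPos_lt_succ j).1⟩) ^ k *
                (X (ι ⟨3 * j.val + 1, (canonPos_lt_succ j).2.1⟩) ^ (2 * k) *
                  X (ι ⟨if j.val = c - 1 then 3 * c - 1 else 3 * j.val + 3,
                    (canonPos_lt_succ j).2.2⟩) ^ (2 * k)) : MvPolynomial (MatIdx m) ℂ) m y ≠ 0) :
    ∃ χ : Weight (MatIdx m), (∃ i j, χ i ≠ χ j) ∧ (2 : ℤ) ^ c ≤ -(Weight.size χ) ∧
      Module.finrank ℂ (↥(highestWeightSpace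
          (orbitCoordRep (rename toLex (perPoly (Fin m) ℂ)) m) χ) ⧸
        Submodule.comap (highestWeightSpace
          (orbitCoordRep (rename toLex (perPoly (Fin m) ℂ)) m) χ).subtype
          (⨆ q : Weight (MatIdx m) × Weight (MatIdx m),
            ⨆ (_ : q.1 + q.2 = χ ∧ q.1 ≠ 0 ∧ q.2 ≠ 0),
              highestWeightSpace (orbitCoordRep (rename toLex (perPoly (Fin m) ℂ)) m) q.1 *
                highestWeightSpace (orbitCoordRep (rename toLex (perPoly (Fin m) ℂ)) m) q.2)) ≠ 0 := by
  classical
  have hιinj := hι.injective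
  -- the placed letters
  set B : Fin c → MatIdx m := fun j => ι ⟨if j.val = 0 then 0 else 3 * j.val - 1,
    (canonPos_lt_succ j).1⟩ with hB
  set A : Fin c → MatIdx m := fun j => ι ⟨3 * j.val + 1, (canonPos_lt_succ j).2.1⟩ with hA
  set A' : Fin c → MatIdx m := fun j => ι ⟨if j.val = c - 1 then 3 * c - 1 else 3 * j.val + 3,
    (canonPos_lt_succ j).2.2⟩ with hA'
  set z : MatIdx m := ι ⟨3 * c, Nat.lt_succ_self _⟩ with hz
  -- distinctness and interleaving, from strict monotonicity
  have hBi : Function.Injective B := by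
    intro i j h
    have h' := Fin.mk.inj_iff.mp (hιinj h)
    apply Fin.ext
    split_ifs at h'
    all_goals omega
  have hAi : Function.Injective A := by
    intro i j h
    have h' := Fin.mk.inj_iff.mp (hιinj h)
    exact Fin.ext (by omega)
  have hA'i : Function.Injective A' := by
    intro i j h
    have h' := Fin.mk.inj_iff.mp (hιinj h)
    apply Fin.ext
    split_ifs at h'
    all_goals omega
  have hBA : ∀ i j, B i ≠ A j := by
    intro i j h
    have h' := Fin.mk.inj_iff.mp (hιinj h)
    split_ifs at h'
    all_goals omega
  have hBA' : ∀ i j, B i ≠ A' j := by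
    intro i j h
    have h' := Fin.mk.inj_iff.mp (hιinj h)
    split_ifs at h'
    all_goals omega
  have hAA' : ∀ i j, A i ≠ A' j := by
    intro i j h
    have h' := Fin.mk.inj_iff.mp (hιinj h)
    split_ifs at h'
    all_goals omega
  have hzB : ∀ j, z ≠ B j := by
    intro j h
    have h' := Fin.mk.inj_iff.mp (hιinj h)
    have := j.isLt
    split_ifs at h'
    all_goals omega
  have hzA : ∀ j, z ≠ A j := by
    intro j h
    have h' := Fin.mk.inj_iff.mp (hιinj h)
    have := j.isLt
    omega
  have hzA' : ∀ j, z ≠ A' j := by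
    intro j h
    have h' := Fin.mk.inj_iff.mp (hιinj h)
    have := j.isLt
    split_ifs at h'
    all_goals omega
  have hord1 : ∀ (j : Fin c) (h : j.val + 1 < c), A j < B ⟨j.val + 1, h⟩ := by
    intro j h
    apply hι
    rw [Fin.mk_lt_mk]
    simp; omega
  have hord2 : ∀ (j : Fin c) (h : j.val + 1 < c), B ⟨j.val + 1, h⟩ < A' j := by
    intro j h
    apply hι
    rw [Fin.mk_lt_mk]
    dsimp only
    split_ifs
    all_goals omega
  -- late generator type of `A(Δ p)`
  obtain ⟨χ, hnc, hge, hγ⟩ := padded_gadget_late_genType_of_eval_ne_zero B A A' z (by omega) hk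
    hBi hAi hA'i hBA hBA' hAA' hzB hzA hzA' hord1 hord2 _ (m := m) (by omega) rfl hGIT
  -- membership of the padded gadget in `Δ(per_m)` and the generator principle
  have hcard : Fintype.card (Fin m) = Fintype.card (Option (Fin c × Fin (5 * k))) := by
    simp only [Fintype.card_fin, Fintype.card_option, Fintype.card_prod]
    rw [hm]; ring
  have hmem := padded_gadget_mem_orbitClosure_perPoly (c := c) hk (Fintype.equivOfCardEq hcard) z B A A'
  exact ⟨χ, hnc, hge, finrank_ne_zero_of_mem_orbitClosure (by omega) hmem χ hγ⟩

/-- Exponential beats quasi-polynomial at the padded parameters: for every `c₀` and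
`t = 2(2c₀+4)²`, `3t + 3 + (3t + 2 + c₀)^c₀ ≤ 4^t`. [folklore] -/
theorem padded_exponent_bound (c₀ t : ℕ) (ht : t = 2 * (2 * c₀ + 2 + 2) ^ 2) :
    3 * t + 3 + (3 * t + 2 + c₀) ^ c₀ ≤ 4 ^ t := by
  have hbase := gadget_exponent_bound (2 * c₀ + 2) t ht
  have htc : c₀ + 1 ≤ t := by rw [ht]; nlinarith
  -- `(3t+2+c₀)^c₀ · (t+2)² ≤ (t+2)^(2c₀+2) ≤ (t+2+(2c₀+2))^(2c₀+2)`
  have h1 : 3 * t + 2 + c₀ ≤ (t + 2) ^ 2 := by nlinarith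
  have h2 : (3 * t + 2 + c₀) ^ c₀ ≤ (t + 2) ^ (2 * c₀) := by
    rw [pow_mul]; exact Nat.pow_le_pow_left h1 _
  have h3 : (t + 2) ^ (2 * c₀) * (t + 2) ^ 2 ≤ (t + 2 + (2 * c₀ + 2)) ^ (2 * c₀ + 2) := by
    rw [← pow_add]; exact Nat.pow_le_pow_left (by omega) _
  have hX : 1 ≤ (3 * t + 2 + c₀) ^ c₀ := Nat.one_le_pow _ _ (by omega)
  have h4 : (3 * t + 2 + c₀) ^ c₀ + 2 * t ≤ (3 * t + 2 + c₀) ^ c₀ * (t + 2) ^ 2 := by nlinarith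
  have h5 : (3 * t + 2 + c₀) ^ c₀ * (t + 2) ^ 2 ≤ (t + 2) ^ (2 * c₀) * (t + 2) ^ 2 :=
    Nat.mul_le_mul_right _ h2
  omega

/-- The padded parameters: with `t = 2(2c₀+4)²`, `k = 2^t`, `c = 4^t`, `m = 5kc + 1`:
`m · 2^((log₂ m + c₀)^c₀) < 2^c`. [folklore] -/
theorem padded_parameters_at (c₀ t : ℕ) (ht : t = 2 * (2 * c₀ + 2 + 2) ^ 2) :
    (5 * 2 ^ t * 4 ^ t + 1) * 2 ^ ((Nat.log 2 (5 * 2 ^ t * 4 ^ t + 1) + c₀) ^ c₀) < 2 ^ (4 ^ t) := by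
  have h4 : (4 : ℕ) ^ t = 2 ^ t * 2 ^ t := by rw [show (4 : ℕ) = 2 * 2 by norm_num, mul_pow]
  have hm : 5 * 2 ^ t * 4 ^ t + 1 < 2 ^ (3 * t + 3) := by
    have h8 : (2 : ℕ) ^ (3 * t + 3) = 8 * (2 ^ t * (2 ^ t * 2 ^ t)) := by
      rw [show 3 * t + 3 = ((t + t) + t) + 3 by ring, pow_add, pow_add, pow_add]; norm_num; ring
    rw [h4, h8]
    have hP : 0 < 2 ^ t * (2 ^ t * 2 ^ t) := by positivity
    linarith [hP]
  have hlog : Nat.log 2 (5 * 2 ^ t * 4 ^ t + 1) ≤ 3 * t + 2 :=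
    Nat.lt_succ_iff.mp (Nat.log_lt_of_lt_pow (b := 2) (by positivity) hm)
  have hexp : (Nat.log 2 (5 * 2 ^ t * 4 ^ t + 1) + c₀) ^ c₀ ≤ (3 * t + 2 + c₀) ^ c₀ :=
    Nat.pow_le_pow_left (by omega) _
  calc (5 * 2 ^ t * 4 ^ t + 1) * 2 ^ ((Nat.log 2 (5 * 2 ^ t * 4 ^ t + 1) + c₀) ^ c₀)
      < 2 ^ (3 * t + 3) * 2 ^ ((3 * t + 2 + c₀) ^ c₀) :=
        Nat.mul_lt_mul_of_lt_of_le hm (Nat.pow_le_pow_right (by norm_num) hexp) (by positivity)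
    _ = 2 ^ (3 * t + 3 + (3 * t + 2 + c₀) ^ c₀) := by rw [← pow_add]
    _ ≤ 2 ^ (4 ^ t) := Nat.pow_le_pow_right (by norm_num) (padded_exponent_bound c₀ t ht)

/-- **K1 from the padded certificate.**  If for every `t ≥ 1` (`k = 2^t`, `c = 4^t`, `m = 5kc+1`) and
every strictly monotone `ι : Fin (3c+1) → MatIdx m` some highest-weight vector of NONCONSTANT weight of
`ℂ[Δ_m p]` does not vanish at the padded gadget
`p = x_{ι(3c)}^{(c-1)5k+1} · Σ_{j<c} x_{ι(B j)}^k x_{ι(A j)}^{2k} x_{ι(A' j)}^{2k}`, then `PerGenDegreeSuperQP`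
(K1) holds: the padded gadget lies in `Δ(per_m)` (hub construction), its lateness is `2^c`, and
`m · 2^((log₂ m + c₀)^c₀) < 2^c` at `t = 2(2c₀+4)²` (`padded_parameters_at`).
[cite: GesmundoIkenmeyerPanova2017, Prop. 5] -/
theorem perGenDegreeSuperQP_of_paddedGadgetGIT
    (hGIT : ∀ (t : ℕ), 1 ≤ t → ∀ (ι : Fin (3 * 4 ^ t + 1) → MatIdx (5 * 2 ^ t * 4 ^ t + 1)),
      StrictMono ι →
      ∃ χ₀ : Weight (MatIdx (5 * 2 ^ t * 4 ^ t + 1)), (∃ a b, χ₀ a ≠ χ₀ b) ∧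
        ∃ y ∈ highestWeightSpace (orbitCoordRep
            ((X (ι ⟨3 * 4 ^ t, Nat.lt_succ_self _⟩)) ^ ((4 ^ t - 1) * (5 * 2 ^ t) + 1) *
              ∑ j : Fin (4 ^ t),
                X (ι ⟨if j.val = 0 then 0 else 3 * j.val - 1, (canonPos_lt_succ j).1⟩) ^ (2 ^ t) *
                  (X (ι ⟨3 * j.val + 1, (canonPos_lt_succ j).2.1⟩) ^ (2 * 2 ^ t) *
                    X (ι ⟨if j.val = 4 ^ t - 1 then 3 * 4 ^ t - 1 else 3 * j.val + 3,
                      (canonPos_lt_succ j).2.2⟩) ^ (2 * 2 ^ t)) :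
                MvPolynomial (MatIdx (5 * 2 ^ t * 4 ^ t + 1)) ℂ) (5 * 2 ^ t * 4 ^ t + 1)) χ₀,
          evalAtPoint ((X (ι ⟨3 * 4 ^ t, Nat.lt_succ_self _⟩)) ^ ((4 ^ t - 1) * (5 * 2 ^ t) + 1) *
              ∑ j : Fin (4 ^ t),
                X (ι ⟨if j.val = 0 then 0 else 3 * j.val - 1, (canonPos_lt_succ j).1⟩) ^ (2 ^ t) *
                  (X (ι ⟨3 * j.val + 1, (canonPos_lt_succ j).2.1⟩) ^ (2 * 2 ^ t) *
                    X (ι ⟨if j.val = 4 ^ t - 1 then 3 * 4 ^ t - 1 else 3 * j.val + 3,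
                      (canonPos_lt_succ j).2.2⟩) ^ (2 * 2 ^ t)) :
                MvPolynomial (MatIdx (5 * 2 ^ t * 4 ^ t + 1)) ℂ) (5 * 2 ^ t * 4 ^ t + 1) y ≠ 0) :
    PerGenDegreeSuperQP := by
  intro c₀ m₀
  set c₁ : ℕ := max c₀ m₀ with hc₁
  set t : ℕ := 2 * (2 * c₁ + 2 + 2) ^ 2 with htdef
  have ht1 : 1 ≤ t := by rw [htdef]; nlinarith
  have hk1 : 1 ≤ 2 ^ t := Nat.one_le_two_pow
  have hc1 : 1 ≤ 4 ^ t := Nat.one_le_pow _ _ (by norm_num)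
  set m : ℕ := 5 * 2 ^ t * 4 ^ t + 1 with hmdef
  -- a strictly monotone placement of the `3c + 1` letters exists (`3c+1 ≤ m²`)
  have hcard : Fintype.card (Fin (3 * 4 ^ t + 1)) ≤ Fintype.card (MatIdx (5 * 2 ^ t * 4 ^ t + 1)) := by
    rw [Fintype.card_fin, Fintype.card_lex, Fintype.card_prod, Fintype.card_fin]
    have hX : 3 * 4 ^ t + 1 ≤ 5 * 2 ^ t * 4 ^ t + 1 := by
      have := Nat.mul_le_mul_right (4 ^ t) (show 3 ≤ 5 * 2 ^ t by omega)
      linarith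
    exact hX.trans (Nat.le_mul_self _)
  obtain ⟨ι, hι, -⟩ := exists_strictMono_isUpperSet (σ := Fin (3 * 4 ^ t + 1))
    (τ := MatIdx (5 * 2 ^ t * 4 ^ t + 1)) hcard
  obtain ⟨χ, -, hge, hγ⟩ := per_late_genType_of_paddedGIT (k := 2 ^ t) (c := 4 ^ t)
    (m := 5 * 2 ^ t * 4 ^ t + 1) hk1 hc1 rfl ι hι (hGIT t ht1 ι hι)
  refine ⟨5 * 2 ^ t * 4 ^ t + 1, ?_, χ, hγ, ?_⟩
  · -- `m₀ ≤ c₁ ≤ t ≤ 2^t ≤ m`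
    have h1 : c₁ ≤ t := by rw [htdef]; nlinarith
    have h2 : t ≤ 2 ^ t := Nat.lt_two_pow_self.le
    have h3 : m₀ ≤ c₁ := le_max_right _ _
    nlinarith [hc1]
  · -- lateness, with `c₀ ≤ c₁`
    have hlate := padded_parameters_at c₁ t htdef
    have hlog1 : 1 ≤ Nat.log 2 (5 * 2 ^ t * 4 ^ t + 1) := by
      have h : 2 ^ 1 ≤ 5 * 2 ^ t * 4 ^ t + 1 := by nlinarith [hk1, hc1]
      have := Nat.log_mono_right (b := 2) h
      rwa [Nat.log_pow (by norm_num)] at this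
    have hmono : (Nat.log 2 (5 * 2 ^ t * 4 ^ t + 1) + c₀) ^ c₀ ≤
        (Nat.log 2 (5 * 2 ^ t * 4 ^ t + 1) + c₁) ^ c₁ :=
      calc (Nat.log 2 (5 * 2 ^ t * 4 ^ t + 1) + c₀) ^ c₀
          ≤ (Nat.log 2 (5 * 2 ^ t * 4 ^ t + 1) + c₁) ^ c₀ :=
            Nat.pow_le_pow_left (by have := le_max_left c₀ m₀; omega) _
        _ ≤ (Nat.log 2 (5 * 2 ^ t * 4 ^ t + 1) + c₁) ^ c₁ :=
            Nat.pow_le_pow_right (by omega) (le_max_left _ _)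
    have hlate' : (5 * 2 ^ t * 4 ^ t + 1) * 2 ^ ((Nat.log 2 (5 * 2 ^ t * 4 ^ t + 1) + c₀) ^ c₀) <
        2 ^ (4 ^ t) :=
      lt_of_le_of_lt (Nat.mul_le_mul_left _ (Nat.pow_le_pow_right (by norm_num) hmono)) hlate
    have hcast : ((5 * 2 ^ t * 4 ^ t + 1 : ℕ) : ℤ) *
        2 ^ ((Nat.log 2 (5 * 2 ^ t * 4 ^ t + 1) + c₀) ^ c₀) < (2 : ℤ) ^ (4 ^ t) := by
      exact_mod_cast hlate'
    push_cast at hcast ⊢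
    exact lt_of_lt_of_le hcast hge

end

end Summit.ValiantsHypothesis.ValiantsHypothesis.Theorems.GeneratorObstructions.PerGenDegreeSuperQP
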